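import Mathlib.GroupTheory.Transfer
import Mathlib.GroupTheory.DoubleCoset
import Mathlib.GroupTheory.Commensurable
import Mathlib.Algebra.Group.TypeTags.Hom
import HarnessLib

/-!
# The Hecke operator `[Γ g Γ]` on `Hom(Γ, A) = H¹(Γ, A)` (trivial coefficients)

Topic `NumberTheory/Automorphic`; namespace `Literature.NumberTheory.Automorphic`, the operator in
the sub-namespace `….Automorphic.Subgroup` (topic namespace, NOT Mathlib's root `Subgroup`; write
`Subgroup.heckeOperatorHom Γ g` after `open Literature.NumberTheory.Automorphic`).

`G` a group, `Γ ≤ G`, `g ∈ G`, `A` a commutative group with trivial `Γ`-action, so that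
`H¹(Γ, A) = Hom(Γ, A)` (Mathlib `groupCohomology.H1IsoOfIsTrivial`).  Shimura's action of the
double coset [ShimuraIATAF1971, §8.3, (8.3.2), p. 237] (there for `R[Δ]`-modules `X`; for trivial
action the factor `αᵢ^ι` drops): if `Γ g Γ = ⨆ᵢ Γ rᵢ` (finite disjoint union of right cosets;
their number is `d = [Γ : Γ ∩ g⁻¹Γg]`, [ShimuraIATAF1971, §3.1, Prop. 3.1, p. 51]) and, for
`γ ∈ Γ`, `rᵢ γ = eᵢ r_{s(i)}` with `eᵢ ∈ Γ`, then `([Γ g Γ] c)(γ) = ∑ᵢ c(eᵢ)` — (∗).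
Equivalently `[Γ g Γ] = cor ∘ g^* ∘ res` along `Γ_g := Γ ∩ g⁻¹Γg`, `x ↦ g x g⁻¹ : Γ_g → Γ`, where
on `H¹ = Hom` the corestriction is the **transfer** (Mathlib `MonoidHom.transfer`).  We DEFINE
the operator by the second description and PROVE (∗) for every admissible choice of the `rᵢ`,
`s`, `eᵢ` (independence of the representatives; the computable form).  All proved, no facts:

* `Subgroup.heckeSubgroup Γ g = Γ_g` (`= Γ ⊓ g⁻¹Γg` in `Γ`: `heckeSubgroup_eq_subgroupOf`;
  finite index on the commensurator: `finiteIndex_heckeSubgroup_of_mem_commensurator`;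
  `[Γ : Γ_g] = #ι` for representatives `r : ι → G`: `index_heckeSubgroup_eq_card`),
  `Subgroup.heckeConj Γ g : Γ_g →* Γ`, and `Subgroup.heckeOperatorHom Γ g : (Γ →* A) →* (Γ →* A)`
  (multiplicative notation; additivity in `c` is `map_mul`), junk value `1` when `[Γ : Γ_g] = ∞`.
* `heckeOperatorHom_apply` (`= transfer (c ∘ heckeConj)`, i.e. `cor ∘ g^* ∘ res`),
  `heckeOperatorHom_apply_eq_prod` (formula (∗)), the degree formula
  `heckeOperatorHom_comp_inclusion` (`[Γ g Γ] (χ|_Γ) = (χ|_Γ) ^ [Γ : Γ_g]` for `χ` a homomorphism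
  on `Δ ⊇ Γ ∋ g`) and `heckeOperatorHom_of_mem` (`[Γ g Γ] = id` for `g ∈ Γ`).
* additive coefficients `B` (the `H1IsoOfIsTrivial` convention `Additive Γ →+ B`):
  `Subgroup.heckeOperatorAddHom Γ g`, `heckeOperatorAddHom_apply_eq_sum` ((∗) with `∑`),
  `heckeOperatorAddHom_comp_inclusion` (`= [Γ : Γ_g] • c`).
* transfer lemmas for any finite-index `H ≤ K`: evaluation on a right transversal indexed by a
  finite type (`transfer_eq_prod_of_rightReps`), transfer of a restriction
  (`transfer_comp_subtype_apply`: `χ(k)^[K:H]`), `transfer_mul`, `transfer_one`.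

Handedness: right cosets `Γ rᵢ` and `Γ_g = Γ ∩ g⁻¹Γg` as printed in Shimura; for the other
convention replace `g` by `g⁻¹` (both indices are finite on the commensurator).  NOT here:
non-trivial coefficients, parabolic cohomology `H¹_P`, products of double cosets, adjointness.

## References

* G. Shimura, *Introduction to the arithmetic theory of automorphic functions* (1971), §3.1,
  Prop. 3.1 (p. 51); §8.3, (8.3.2)–(8.3.3) (p. 237) [ShimuraIATAF1971].
* Y. H. Rhie, G. Whaples, *Hecke operators in cohomology of groups*, J. Math. Soc. Japan 22 (1970)
  431–442 (the `cor ∘ conj ∘ res` description; orientation only, not cited in tags).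
-/
noncomputable section

open scoped Pointwise

namespace Literature.NumberTheory.Automorphic

variable {A : Type*} [CommGroup A]

/-! ### Transfer lemmas -/
section Transfer

variable {K : Type*} [Group K] {H : Subgroup K}

/-- The transfer is multiplicative in the homomorphism: `V(ϕ ψ) = V(ϕ) V(ψ)`. [folklore] -/
theorem transfer_mul [H.FiniteIndex] (ϕ ψ : H →* A) :
    (ϕ * ψ).transfer = ϕ.transfer * ψ.transfer := by
  ext k
  simp only [MonoidHom.mul_apply, MonoidHom.transfer_def _ default,
    Subgroup.leftTransversals.diff, ← Finset.prod_mul_distrib]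

/-- The transfer of the trivial homomorphism is trivial. [folklore] -/
theorem transfer_one [H.FiniteIndex] : (1 : H →* A).transfer = (1 : K →* A) := by
  ext k
  simp only [MonoidHom.one_apply, MonoidHom.transfer_def _ default,
    Subgroup.leftTransversals.diff, Finset.prod_const_one]

/-- Right coset representatives indexed by a type `ι`: if every `k ∈ K` lies in `H δᵢ` for a
unique `i`, then `i ↦ δᵢ⁻¹ H` is a bijection `ι → K ⧸ H`. [folklore] -/
theorem bijective_mk_inv_of_rightReps {ι : Type*} (δ : ι → K)
    (hδ : ∀ k : K, ∃! i, k * (δ i)⁻¹ ∈ H) :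
    Function.Bijective fun i => (((δ i)⁻¹ : K) : K ⧸ H) := by
  refine ⟨fun i j hij => ?_, fun q => ?_⟩
  · have h : δ i * (δ j)⁻¹ ∈ H := by simpa using QuotientGroup.eq.1 hij
    obtain ⟨i₀, -, huniq⟩ := hδ (δ i)
    exact (huniq i (by simp)).trans (huniq j h).symm
  · induction q using QuotientGroup.induction_on with
    | H x =>
      obtain ⟨i, hi, -⟩ := hδ x⁻¹
      refine ⟨i, QuotientGroup.eq.2 ?_⟩
      simpa [mul_inv_rev] using H.inv_mem hi

/-- With `δ` as in `bijective_mk_inv_of_rightReps` and `ι` finite, `[K : H] < ∞`. [folklore] -/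
theorem finiteIndex_of_rightReps {ι : Type*} [Finite ι] (δ : ι → K)
    (hδ : ∀ k : K, ∃! i, k * (δ i)⁻¹ ∈ H) : H.FiniteIndex :=
  haveI : Finite (K ⧸ H) := Finite.of_surjective _ (bijective_mk_inv_of_rightReps δ hδ).2
  Subgroup.finiteIndex_of_finite_quotient

/-- With `δ` as in `bijective_mk_inv_of_rightReps`, `[K : H] = #ι`. [folklore] -/
theorem index_eq_card_of_rightReps {ι : Type*} [Fintype ι] (δ : ι → K)
    (hδ : ∀ k : K, ∃! i, k * (δ i)⁻¹ ∈ H) : H.index = Fintype.card ι := by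
  rw [Subgroup.index_eq_card, ← Nat.card_eq_fintype_card]
  exact (Nat.card_congr (Equiv.ofBijective _ (bijective_mk_inv_of_rightReps δ hδ))).symm

/-- **Transfer on a right transversal.**  Let `δ : ι → K` (`ι` finite) represent the right
cosets of `H` (`K = ⨆ᵢ H δᵢ`), `k ∈ K`, and `δᵢ k = lᵢ δ_{σ(i)}` with `lᵢ ∈ H`.  Then
`V(ϕ)(k) = ∏ᵢ ϕ(lᵢ)` (Mathlib defines `V` through left transversals and `diff`). [folklore] -/
theorem transfer_eq_prod_of_rightReps [H.FiniteIndex] (ϕ : H →* A) {ι : Type*} [Fintype ι]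
    (δ : ι → K) (hδ : ∀ k : K, ∃! i, k * (δ i)⁻¹ ∈ H) (k : K) (σ : ι → ι) (l : ι → K)
    (hl : ∀ i, l i ∈ H) (h : ∀ i, δ i * k = l i * δ (σ i)) :
    ϕ.transfer k = ∏ i, ϕ ⟨l i, hl i⟩ := by
  classical
  letI := H.fintypeQuotientOfFiniteIndex
  set E : ι ≃ K ⧸ H := Equiv.ofBijective _ (bijective_mk_inv_of_rightReps δ hδ)
  set f : K ⧸ H → K := fun q => (δ (E.symm q))⁻¹ with hf_def
  have hf : ∀ q, (f q : K ⧸ H) = q := fun q => E.apply_symm_apply q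
  set T : H.LeftTransversal := ⟨Set.range f, Subgroup.isComplement_range_left hf⟩
  have hTq : ∀ q, ((T.2.leftQuotientEquiv q : Set.range f) : K) = f q := fun q =>
    Subgroup.IsComplement.leftQuotientEquiv_apply hf q
  -- `E (σ i) = k⁻¹ • E i`
  have hσ : ∀ i, E.symm (k⁻¹ • E i) = σ i := fun i => by
    rw [Equiv.symm_apply_eq]
    show k⁻¹ • (((δ i)⁻¹ : K) : K ⧸ H) = (((δ (σ i))⁻¹ : K) : K ⧸ H)
    rw [MulAction.Quotient.smul_coe, smul_eq_mul, QuotientGroup.eq, mul_inv_rev, inv_inv, inv_inv,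
      h i, mul_inv_cancel_right]
    exact hl i
  rw [MonoidHom.transfer_def ϕ T k]; simp only [Subgroup.leftTransversals.diff]
  refine (Fintype.prod_equiv E _ _ fun i => congr_arg ϕ (Subtype.ext ?_)).symm
  simp only [Subgroup.smul_apply_eq_smul_apply_inv_smul, hTq, smul_eq_mul, hf_def,
    Equiv.symm_apply_apply, hσ i, inv_inv]
  rw [← mul_assoc, h i, mul_inv_cancel_right]

/-- **Transfer of a restriction.**  If `ϕ = χ|_H` for a homomorphism `χ : K →* A`, then
`V(ϕ)(k) = χ(k)^[K:H]`. [folklore] -/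
theorem transfer_comp_subtype_apply [H.FiniteIndex] (χ : K →* A) (k : K) :
    (χ.comp H.subtype).transfer k = χ k ^ H.index := by
  classical
  letI := H.fintypeQuotientOfFiniteIndex
  set T : H.LeftTransversal := default
  rw [MonoidHom.transfer_def _ T]
  simp only [Subgroup.leftTransversals.diff, MonoidHom.comp_apply, Subgroup.coe_subtype,
    map_mul, map_inv, Finset.prod_mul_distrib, Finset.prod_inv_distrib,
    Subgroup.smul_apply_eq_smul_apply_inv_smul, smul_eq_mul, Finset.prod_const,
    Finset.card_univ]
  rw [Fintype.prod_equiv (MulAction.toPerm k⁻¹)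
    (fun q => χ ((T.2.leftQuotientEquiv (k⁻¹ • q) : (T : Set K)) : K))
    (fun q => χ ((T.2.leftQuotientEquiv q : (T : Set K)) : K)) fun _ => rfl]
  rw [Subgroup.index_eq_card, Nat.card_eq_fintype_card, mul_comm, mul_assoc, mul_inv_cancel,
    mul_one]

end Transfer

/-! ### The subgroup `Γ_g = Γ ∩ g⁻¹ Γ g` and the operator -/

namespace Subgroup

variable {G : Type*} [Group G] (Γ : _root_.Subgroup G) (g : G)

/-- `Γ_g := {γ ∈ Γ | g γ g⁻¹ ∈ Γ} = Γ ∩ g⁻¹ Γ g` as a subgroup of `Γ` (source of `cor` in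
`[Γ g Γ] = cor ∘ g^* ∘ res`; `Γ_g \ Γ ≃ Γ \ Γ g Γ` via `δ ↦ Γ g δ`).  Declared as
`Literature.NumberTheory.Automorphic.Subgroup.heckeSubgroup`. [cite: ShimuraIATAF1971, Prop. 3.1] -/
def heckeSubgroup : _root_.Subgroup Γ :=
  Γ.comap ((MulAut.conj g).toMonoidHom.comp Γ.subtype)

/-- Membership in `Γ_g`: `γ ∈ Γ_g ↔ g γ g⁻¹ ∈ Γ`. [folklore] -/
@[simp]
theorem mem_heckeSubgroup {γ : Γ} : γ ∈ heckeSubgroup Γ g ↔ g * γ * g⁻¹ ∈ Γ := Iff.rfl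

/-- `Γ_g` is `Γ ⊓ g⁻¹ Γ g` viewed inside `Γ` (Mathlib's conjugation action of `ConjAct G` on
subgroups). [folklore] -/
theorem heckeSubgroup_eq_subgroupOf :
    heckeSubgroup Γ g = (ConjAct.toConjAct g⁻¹ • Γ).subgroupOf Γ := by
  ext γ
  rw [mem_heckeSubgroup, _root_.Subgroup.mem_subgroupOf,
    _root_.Subgroup.mem_pointwise_smul_iff_inv_smul_mem, ← ConjAct.toConjAct_inv, inv_inv,
    ConjAct.toConjAct_smul]

/-- For `g` in the commensurator of `Γ`, `[Γ : Γ_g]` (`= (g⁻¹Γg).relIndex Γ`) is finite, so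
`Γ \ Γ g Γ` is finite and no junk value occurs. [cite: ShimuraIATAF1971, Prop. 3.1] -/
theorem finiteIndex_heckeSubgroup_of_mem_commensurator
    (hg : g ∈ _root_.Subgroup.Commensurable.commensurator Γ) :
    (heckeSubgroup Γ g).FiniteIndex := by
  refine ⟨?_⟩
  rw [heckeSubgroup_eq_subgroupOf]
  exact ((_root_.Subgroup.Commensurable.commensurator_mem_iff Γ g⁻¹).1 (inv_mem hg)).1

/-- `Γ_g = Γ` when `g ∈ Γ`. [folklore] -/
theorem heckeSubgroup_of_mem (hg : g ∈ Γ) : heckeSubgroup Γ g = ⊤ := by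
  ext γ
  simpa using Γ.mul_mem (Γ.mul_mem hg γ.2) (Γ.inv_mem hg)

/-- The conjugation `γ ↦ g γ g⁻¹ : Γ_g →* Γ` (the `g^*` of `cor ∘ g^* ∘ res`). [folklore] -/
def heckeConj : heckeSubgroup Γ g →* Γ :=
  (((MulAut.conj g).toMonoidHom.comp Γ.subtype).comp (heckeSubgroup Γ g).subtype).codRestrict Γ
    fun γ => γ.2

/-- `heckeConj Γ g γ = g γ g⁻¹` in `G`. [folklore] -/
@[simp]
theorem coe_heckeConj_apply (γ : heckeSubgroup Γ g) : (heckeConj Γ g γ : G) = g * γ * g⁻¹ := rfl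

open scoped Classical in
/-- **The Hecke operator `[Γ g Γ]` on `Hom(Γ, A) = H¹(Γ, A)`** (trivial action on the commutative
group `A`, written multiplicatively): `[Γ g Γ] c := V_{Γ_g}^{Γ}(c ∘ (γ ↦ g γ g⁻¹))`, the transfer
(= corestriction on `H¹`) of the pulled-back homomorphism `Γ_g → A`, a group homomorphism in `c`;
computed by Shimura's (8.3.2), `([Γ g Γ] c)(γ) = ∏ᵢ c(eᵢ)` for `Γ g Γ = ⨆ Γ rᵢ`,
`rᵢ γ = eᵢ r_{s(i)}` (`heckeOperatorHom_apply_eq_prod`).  Junk value: the trivial operator when `[Γ : Γ_g] = ∞`.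
Declared as `Literature.NumberTheory.Automorphic.Subgroup.heckeOperatorHom` (topic namespace).
[cite: ShimuraIATAF1971, §8.3, (8.3.2)] -/
def heckeOperatorHom : (Γ →* A) →* (Γ →* A) :=
  if h : (heckeSubgroup Γ g).FiniteIndex then
    { toFun := fun c => (c.comp (heckeConj Γ g)).transfer
      map_one' := by rw [MonoidHom.one_comp]; exact transfer_one
      map_mul' := fun c₁ c₂ => by rw [MonoidHom.mul_comp]; exact transfer_mul _ _ }
  else 1

/-- `[Γ g Γ] = cor ∘ g^* ∘ res`: for `[Γ : Γ_g] < ∞`, `[Γ g Γ] c` is the transfer of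
`c ∘ heckeConj : Γ_g →* A`. [cite: ShimuraIATAF1971, §8.3] -/
theorem heckeOperatorHom_apply [h : (heckeSubgroup Γ g).FiniteIndex] (c : Γ →* A) :
    heckeOperatorHom Γ g c = (c.comp (heckeConj Γ g)).transfer := by
  rw [heckeOperatorHom, dif_pos h]
  rfl

/-- The junk value: `[Γ g Γ] = 1` when `Γ_g` has infinite index in `Γ`. [folklore] -/
theorem heckeOperatorHom_of_not_finiteIndex (h : ¬ (heckeSubgroup Γ g).FiniteIndex) :
    (heckeOperatorHom Γ g : (Γ →* A) →* (Γ →* A)) = 1 := by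
  rw [heckeOperatorHom, dif_neg h]

variable {Γ g}

/-- If `Γ g Γ = ⨆ Γ rᵢ` and `Γ rᵢ = Γ g dᵢ` with `dᵢ ∈ Γ`, then `Γ = ⨆ Γ_g dᵢ` (proof of
Prop. 3.1 in Shimura). [cite: ShimuraIATAF1971, Prop. 3.1] -/
theorem existsUnique_mul_inv_mem_heckeSubgroup {ι : Type*} {r : ι → G}
    (hr' : ∀ x ∈ DoubleCoset.doubleCoset g (Γ : Set G) Γ, ∃! i, x * (r i)⁻¹ ∈ Γ)
    (d : ι → Γ) (hd : ∀ i, r i * (g * d i)⁻¹ ∈ Γ) (k : Γ) :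
    ∃! i, k * (d i)⁻¹ ∈ heckeSubgroup Γ g := by
  have hx : g * (k : G) ∈ DoubleCoset.doubleCoset g (Γ : Set G) Γ :=
    DoubleCoset.mem_doubleCoset.2 ⟨1, Γ.one_mem, k, k.2, by rw [one_mul]⟩
  refine (existsUnique_congr fun i => ?_).1 (hr' _ hx)
  have : g * (k : G) * (r i)⁻¹ = g * ((k * (d i)⁻¹ : Γ) : G) * g⁻¹ * (r i * (g * d i)⁻¹)⁻¹ := by
    simp only [_root_.Subgroup.coe_mul, InvMemClass.coe_inv, mul_inv_rev, inv_inv]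
    group
  rw [this, _root_.Subgroup.mul_mem_cancel_right _ (Γ.inv_mem (hd i)), mem_heckeSubgroup]

/-- If `Γ g Γ` is a finite union `⨆_{i ∈ ι} Γ rᵢ`, then `[Γ : Γ_g] < ∞`. [folklore] -/
theorem finiteIndex_heckeSubgroup_of_reps {ι : Type*} [Finite ι] {r : ι → G}
    (hr : ∀ i, r i ∈ DoubleCoset.doubleCoset g (Γ : Set G) Γ)
    (hr' : ∀ x ∈ DoubleCoset.doubleCoset g (Γ : Set G) Γ, ∃! i, x * (r i)⁻¹ ∈ Γ) :
    (heckeSubgroup Γ g).FiniteIndex := by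
  choose a ha d hd hr_eq using fun i => DoubleCoset.mem_doubleCoset.1 (hr i)
  refine finiteIndex_of_rightReps (fun i => (⟨d i, hd i⟩ : Γ))
    (existsUnique_mul_inv_mem_heckeSubgroup hr' _ fun i => ?_)
  simpa [hr_eq i, mul_assoc] using ha i

/-- If `Γ g Γ = ⨆_{i ∈ ι} Γ rᵢ`, then `[Γ : Γ_g] = #ι` (the degree of `[Γ g Γ]`). [folklore] -/
theorem index_heckeSubgroup_eq_card {ι : Type*} [Fintype ι] {r : ι → G}
    (hr : ∀ i, r i ∈ DoubleCoset.doubleCoset g (Γ : Set G) Γ)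
    (hr' : ∀ x ∈ DoubleCoset.doubleCoset g (Γ : Set G) Γ, ∃! i, x * (r i)⁻¹ ∈ Γ) :
    (heckeSubgroup Γ g).index = Fintype.card ι := by
  choose a ha d hd hr_eq using fun i => DoubleCoset.mem_doubleCoset.1 (hr i)
  refine index_eq_card_of_rightReps (fun i => (⟨d i, hd i⟩ : Γ))
    (existsUnique_mul_inv_mem_heckeSubgroup hr' _ fun i => ?_)
  simpa [hr_eq i, mul_assoc] using ha i

/-- **Shimura's formula (8.3.2) / independence of the representatives.**  Let `r : ι → G`
(`ι` finite) be representatives of the right cosets of `Γ` in `Γ g Γ` — each `rᵢ ∈ Γ g Γ` and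
every `x ∈ Γ g Γ` lies in `Γ rᵢ` for exactly one `i` — and, for `γ ∈ Γ`, let `s : ι → ι` and
`e : ι → Γ` satisfy `rᵢ γ = eᵢ r_{s(i)}`.  Then `([Γ g Γ] c)(γ) = ∏ᵢ c(eᵢ)`, whatever the choices.
[cite: ShimuraIATAF1971, §8.3, (8.3.2)–(8.3.3)] -/
theorem heckeOperatorHom_apply_eq_prod {ι : Type*} [Fintype ι] (r : ι → G)
    (hr : ∀ i, r i ∈ DoubleCoset.doubleCoset g (Γ : Set G) Γ)
    (hr' : ∀ x ∈ DoubleCoset.doubleCoset g (Γ : Set G) Γ, ∃! i, x * (r i)⁻¹ ∈ Γ)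
    (c : Γ →* A) (γ : Γ) (s : ι → ι) (e : ι → Γ) (hres : ∀ i, r i * γ = e i * r (s i)) :
    heckeOperatorHom Γ g c γ = ∏ i, c (e i) := by
  classical
  choose a ha d hd hr_eq using fun i => DoubleCoset.mem_doubleCoset.1 (hr i)
  haveI := finiteIndex_heckeSubgroup_of_reps hr hr'
  have hδ : ∀ k : Γ, ∃! i, k * (⟨d i, hd i⟩ : Γ)⁻¹ ∈ heckeSubgroup Γ g :=
    existsUnique_mul_inv_mem_heckeSubgroup hr' _ fun i => by simpa [hr_eq i, mul_assoc] using ha i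
  -- `s` is a permutation of the finite type `ι`
  have hs : Function.Bijective s := by
    refine Finite.injective_iff_bijective.1 fun i j hij => ?_
    obtain ⟨i₀, -, huniq⟩ := hr' _ (hr i)
    refine (huniq i (by simp)).trans (huniq j ?_).symm
    have h12 : ∀ i, r i * γ * (r (s i))⁻¹ ∈ Γ := fun i => by
      rw [hres i, mul_inv_cancel_right]; exact (e i).2
    simpa [mul_assoc, hij] using Γ.mul_mem (h12 i) (Γ.inv_mem (h12 j))
  -- `eᵢ = aᵢ g dᵢ γ (a_{s i} g d_{s i})⁻¹`, so `g (dᵢ γ d_{s i}⁻¹) g⁻¹ = aᵢ⁻¹ eᵢ a_{s i} ∈ Γ`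
  have he : ∀ i, (e i : G) = a i * g * d i * γ * (a (s i) * g * d (s i))⁻¹ := fun i => by
    rw [eq_mul_inv_iff_mul_eq, ← hr_eq (s i), ← hres i, hr_eq i]
  have hconj : ∀ i, g * ((⟨d i, hd i⟩ * γ * ⟨d (s i), hd (s i)⟩⁻¹ : Γ) : G) * g⁻¹ =
      (a i)⁻¹ * e i * a (s i) := fun i => by
    simp only [_root_.Subgroup.coe_mul, InvMemClass.coe_inv, he i, mul_inv_rev]
    group
  have hl : ∀ i, (⟨d i, hd i⟩ * γ * ⟨d (s i), hd (s i)⟩⁻¹ : Γ) ∈ heckeSubgroup Γ g := fun i => by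
    rw [mem_heckeSubgroup, hconj]
    exact Γ.mul_mem (Γ.mul_mem (Γ.inv_mem (ha i)) (e i).2) (ha (s i))
  rw [heckeOperatorHom_apply, transfer_eq_prod_of_rightReps _ (fun i => (⟨d i, hd i⟩ : Γ)) hδ γ s
    _ hl fun i => (inv_mul_cancel_right _ _).symm]
  have key : ∀ i, (c.comp (heckeConj Γ g)) ⟨_, hl i⟩ =
      (c ⟨a i, ha i⟩)⁻¹ * c (e i) * c ⟨a (s i), ha (s i)⟩ := fun i => by
    rw [← map_inv, ← map_mul, ← map_mul, MonoidHom.comp_apply]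
    exact congr_arg c (Subtype.ext (hconj i))
  rw [Finset.prod_congr rfl fun i _ => key i, Finset.prod_mul_distrib, Finset.prod_mul_distrib,
    Finset.prod_inv_distrib, hs.prod_comp fun i => c ⟨a i, ha i⟩, inv_mul_cancel_comm]

variable (Γ g)

/-- **Degree formula.**  If `c = χ|_Γ` for a homomorphism `χ : Δ →* A` on a subgroup `Δ ⊇ Γ`
containing `g`, then `[Γ g Γ] c = c ^ [Γ : Γ_g]` (additively `deg(Γ g Γ) · c`); true also in the
junk case (`index = 0`). [folklore] -/
theorem heckeOperatorHom_comp_inclusion {Δ : _root_.Subgroup G} (hΓΔ : Γ ≤ Δ) (hg : g ∈ Δ)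
    (χ : Δ →* A) :
    heckeOperatorHom Γ g (χ.comp (_root_.Subgroup.inclusion hΓΔ)) =
      χ.comp (_root_.Subgroup.inclusion hΓΔ) ^ (heckeSubgroup Γ g).index := by
  by_cases h : (heckeSubgroup Γ g).FiniteIndex
  · have hc : (χ.comp (_root_.Subgroup.inclusion hΓΔ)).comp (heckeConj Γ g) =
        (χ.comp (_root_.Subgroup.inclusion hΓΔ)).comp (heckeSubgroup Γ g).subtype := by
      ext γ
      simp only [MonoidHom.comp_apply, _root_.Subgroup.coe_subtype]
      have : _root_.Subgroup.inclusion hΓΔ (heckeConj Γ g γ) =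
          ⟨g, hg⟩ * _root_.Subgroup.inclusion hΓΔ γ * ⟨g, hg⟩⁻¹ := Subtype.ext rfl
      rw [this, map_mul, map_mul, map_inv, mul_inv_cancel_comm]
    ext γ
    rw [heckeOperatorHom_apply, hc, transfer_comp_subtype_apply, MonoidHom.pow_apply]
  · rw [heckeOperatorHom_of_not_finiteIndex Γ g h, MonoidHom.one_apply]
    rw [_root_.Subgroup.finiteIndex_iff, not_not] at h
    rw [h, pow_zero]

/-- `[Γ g Γ] = id` on `Hom(Γ, A)` for `g ∈ Γ` (degree formula with `Δ = Γ`, `[Γ : Γ_g] = 1`); in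
particular `[Γ 1 Γ] = id`. [folklore] -/
theorem heckeOperatorHom_of_mem (hg : g ∈ Γ) (c : Γ →* A) : heckeOperatorHom Γ g c = c := by
  have h := heckeOperatorHom_comp_inclusion Γ g le_rfl hg c
  have hc : c.comp (_root_.Subgroup.inclusion (le_refl Γ)) = c := MonoidHom.ext fun _ => rfl
  rwa [hc, heckeSubgroup_of_mem Γ g hg, _root_.Subgroup.index_top, pow_one] at h

/-! ### Additively written coefficients -/

variable {B : Type*} [AddCommGroup B]

/-- The Hecke operator `[Γ g Γ]` on `Hom(Γ, B)` for an ADDITIVE commutative group `B` (Mathlib's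
`H¹(Γ, B) ≅ (Additive Γ →+ B)`, `groupCohomology.H1IsoOfIsTrivial`): `heckeOperatorHom` transported
along `Hom(Γ, Multiplicative B) = (Additive Γ →+ B)`, so `([Γ g Γ] c)(γ) = ∑ᵢ c(eᵢ)` in (8.3.2);
junk value `0` when `[Γ : Γ_g] = ∞`.  Declared as `….Automorphic.Subgroup.heckeOperatorAddHom`.
[cite: ShimuraIATAF1971, §8.3, (8.3.2)] -/
def heckeOperatorAddHom : (Additive Γ →+ B) →+ (Additive Γ →+ B) where
  toFun c := MonoidHom.toAdditiveLeft
    (heckeOperatorHom Γ g (AddMonoidHom.toMultiplicativeRight c))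
  map_zero' := by
    have : AddMonoidHom.toMultiplicativeRight (0 : Additive Γ →+ B) = 1 :=
      MonoidHom.ext fun _ => rfl
    rw [this, map_one]
    exact AddMonoidHom.ext fun _ => rfl
  map_add' c₁ c₂ := by
    have : AddMonoidHom.toMultiplicativeRight (c₁ + c₂) =
        AddMonoidHom.toMultiplicativeRight c₁ * AddMonoidHom.toMultiplicativeRight c₂ :=
      MonoidHom.ext fun _ => rfl
    rw [this, map_mul]
    exact AddMonoidHom.ext fun _ => rfl

/-- Unfolding lemma: `heckeOperatorAddHom` is `heckeOperatorHom` with `Multiplicative B`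
coefficients. [folklore] -/
theorem heckeOperatorAddHom_apply_apply (c : Additive Γ →+ B) (x : Additive Γ) :
    heckeOperatorAddHom Γ g c x =
      (heckeOperatorHom Γ g (AddMonoidHom.toMultiplicativeRight c) x.toMul).toAdd :=
  rfl

variable {Γ g}

/-- Shimura's formula (8.3.2), additive notation: `([Γ g Γ] c)(γ) = ∑ᵢ c(eᵢ)` for
`Γ g Γ = ⨆ Γ rᵢ`, `rᵢ γ = eᵢ r_{s(i)}` (hypotheses as in `heckeOperatorHom_apply_eq_prod`).
[cite: ShimuraIATAF1971, §8.3, (8.3.2)] -/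
theorem heckeOperatorAddHom_apply_eq_sum {ι : Type*} [Fintype ι] (r : ι → G)
    (hr : ∀ i, r i ∈ DoubleCoset.doubleCoset g (Γ : Set G) Γ)
    (hr' : ∀ x ∈ DoubleCoset.doubleCoset g (Γ : Set G) Γ, ∃! i, x * (r i)⁻¹ ∈ Γ)
    (c : Additive Γ →+ B) (γ : Γ) (s : ι → ι) (e : ι → Γ) (hres : ∀ i, r i * γ = e i * r (s i)) :
    heckeOperatorAddHom Γ g c (Additive.ofMul γ) = ∑ i, c (Additive.ofMul (e i)) := by
  rw [heckeOperatorAddHom_apply_apply, toMul_ofMul,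
    heckeOperatorHom_apply_eq_prod r hr hr' _ γ s e hres, toAdd_prod]
  rfl

/-- Degree formula, additive notation: `[Γ g Γ] (χ|_Γ) = [Γ : Γ_g] • χ|_Γ` for `χ` a homomorphism
on `Δ ⊇ Γ ∋ g`. [folklore] -/
theorem heckeOperatorAddHom_comp_inclusion {Δ : _root_.Subgroup G} (hΓΔ : Γ ≤ Δ) (hg : g ∈ Δ)
    (χ : Additive Δ →+ B) :
    heckeOperatorAddHom Γ g (χ.comp (MonoidHom.toAdditive (_root_.Subgroup.inclusion hΓΔ))) =
      (heckeSubgroup Γ g).index •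
        χ.comp (MonoidHom.toAdditive (_root_.Subgroup.inclusion hΓΔ)) := by
  refine AddMonoidHom.ext fun x => ?_
  have hc : AddMonoidHom.toMultiplicativeRight
      (χ.comp (MonoidHom.toAdditive (_root_.Subgroup.inclusion hΓΔ))) =
      (AddMonoidHom.toMultiplicativeRight χ).comp (_root_.Subgroup.inclusion hΓΔ) :=
    MonoidHom.ext fun _ => rfl
  rw [heckeOperatorAddHom_apply_apply, hc, heckeOperatorHom_comp_inclusion Γ g hΓΔ hg,
    MonoidHom.pow_apply, toAdd_pow, AddMonoidHom.nsmul_apply]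
  rfl

end Subgroup

end Literature.NumberTheory.Automorphic
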